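import Literature.NumberTheory.EllipticCurves.InertiaFixedTorsionAdditiveIndexBoundProofs
import Literature.NumberTheory.EllipticCurves.TateModuleTransvectionCriterionProofs
import Literature.NumberTheory.EllipticCurves.TateModuleFreeProofs
import Literature.NumberTheory.EllipticCurves.GreenbergSelmer
import Literature.NumberTheory.GaloisRepresentations.DecompositionGroupOfCompletion
import Mathlib.RingTheory.Nakayama
import Mathlib.RingTheory.FiniteType
import HarnessLib

set_option autoImplicit false

-- the summit and its single problem are both named `BirchSwinnertonDyer` (registry layout D-0017)
set_option linter.dupNamespace false

/-!
# The additive inertia digit: at an ADDITIVE bad prime `v ∤ p`, `p ≥ 5`, some `σ ∈ I_v` has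
# `det (ρ_{E,p}(σ) − 1) ∈ ℤ_p^×` (helper for crux stmt-BirchSwinnertonDyer-20547 `KatoDivisibilityX9`, stub 3 (U))

Port (verbatim, re-homed) of the bsd-f3-mu cell's kernel-checked sketch `U66.lean` ebe50d703ee9c15b §1–§5
(planner-bsd-f3-mu-desc g66, 2026-08-29; port plan PORT-PLAN-72 file P3, desc g72).  For `E = W/ℚ` elliptic, `p` prime
and `v ∤ p` a finite place, with `I_v = GreenbergSelmer.inertia v ≤ Γ_ℚ` the tree's inertia group:

* §1 `exists_forall_mulVec_eq_self_of_forall_det_sub_one_eq_zero` — GROUP STEP in `GL₂(𝔽_p)`: a subgroup of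
  `SL₂(𝔽_p)` all of whose elements have eigenvalue `1` has a common fixed vector (Serre 1972 Prop. 15 via the tree's
  `forall_toGL_mem_or_exists_eigenvector_of_dvd_card`);
* §2 `modPCyclotomicCharacterZMod_eq_one_of_mem_inertia` — `χ̄_p(I_v) = 1` for `v ∤ p`;
* §3 `isUnit_det_galoisRepTate_sub_one_of_injective` — LIFT `E[p] ⇝ T_pE`: `σ̄ − 1` injective on `E[p]` ⟹
  `det (σ − 1) ∈ ℤ_p^×` (Nakayama + Orzech/Vasconcelos);
* §4 `exists_mem_inertia_isUnit_det_sub_one_of_fixed_eq_zero` — `E[p]^{I_v} = 0` ⟹ the digit; §4b the converse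
  `injective_sub_id_of_isUnit_det`, `exists_mem_inertia_isUnit_det_sub_one_iff`;
* §5 `geomTorsion_fixed_eq_zero_of_hasAdditiveReductionAt` (`p ≥ 5`, additive `v ∤ p`: `E[p]^{I_v} = 0`, from the
  tree's bound `#E[p]^{I_v} ≤ 4`) and the headline `exists_mem_inertia_isUnit_det_sub_one_of_hasAdditiveReductionAt`.

Consumed by `…ULedger.lean` (`additiveFixedPointFree_holds`, the additive half of the (U) conjunct for every Hida
datum).  Not ported: U66 §6 (`InertiaUnitAt`, D65-U vocabulary).  No ledger item is closed here; BSD is proved for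
no curve.  References: [Serre1972] §2.4 Prop. 15; [SilvermanAEC2009] Thm. VII.6.1, Prop. III.7.1, III.§7;
[SilvermanATAEC1994] Thm. IV.10.2 (a); [SerreAbelianLadic1968] Ch. I §1.2.
-/

noncomputable section

open scoped Classical MatrixGroups NumberField
open IsDedekindDomain Field Matrix
open Literature.NumberTheory.GaloisRepresentations
open Literature.NumberTheory.GaloisRepresentations.Serre1972
open Literature.NumberTheory.EllipticCurves

namespace Summit.BirchSwinnertonDyer.BirchSwinnertonDyer.Theorems.OneSidedTwistSqueezeX9KatoDivisibilityX9ULedger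

/-! ## §1 The group step in `GL₂(𝔽_p)` -/

/-- **A subgroup of `SL₂(𝔽_p)` all of whose elements have eigenvalue `1` has a common fixed vector.**
Every `g ≠ 1` in `G` is then a transvection of order `p`; if `G ≠ 1`, `p ∣ #G` and Serre's Prop. 15 makes
`G ⊇ SL₂(𝔽_p)` — impossible, `(1 1; −1 0) ∈ SL₂(𝔽_p)` has `det (s − 1) = 1` — or puts `G` in a Borel
subgroup, whose common eigenvector is FIXED by the unipotent elements of `G`.
[cite: Serre1972, §2.4 Prop. 15] -/
theorem exists_forall_mulVec_eq_self_of_forall_det_sub_one_eq_zero {p : ℕ} [Fact p.Prime]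
    (G : Subgroup (GL (Fin 2) (ZMod p)))
    (hdet : ∀ g ∈ G, Matrix.GeneralLinearGroup.det g = 1)
    (hsing : ∀ g ∈ G, ((g : Matrix (Fin 2) (Fin 2) (ZMod p)) - 1).det = 0) :
    ∃ v : Fin 2 → ZMod p, v ≠ 0 ∧ ∀ g ∈ G, (g : Matrix (Fin 2) (Fin 2) (ZMod p)) *ᵥ v = v := by
  -- every `g ∈ G` is unipotent: `(g - 1)² = 0`
  have hunip : ∀ g ∈ G, ((g : Matrix (Fin 2) (Fin 2) (ZMod p)) - 1) *
      ((g : Matrix (Fin 2) (Fin 2) (ZMod p)) - 1) = 0 := by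
    intro g hg
    by_cases hg1 : g = 1
    · rw [hg1, Units.val_one, sub_self, zero_mul]
    · exact (sub_one_ne_zero_and_mul_self_eq_zero_of_orderOf_eq
        (orderOf_eq_of_det_eq_one_of_det_sub_one_eq_zero (hdet g hg) hg1 (hsing g hg))).2
  by_cases hbot : ∀ g ∈ G, g = 1
  · refine ⟨Pi.single 0 1, ?_, fun g hg ↦ ?_⟩
    · intro h
      have h0 := congr_fun h 0
      simp at h0
    · rw [hbot g hg, Units.val_one, Matrix.one_mulVec]
  push Not at hbot
  obtain ⟨g₀, hg₀, hg₀1⟩ := hbot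
  have hpG : p ∣ Nat.card G :=
    dvd_natCard_of_mem_of_orderOf_eq hg₀
      (orderOf_eq_of_det_eq_one_of_det_sub_one_eq_zero (hdet g₀ hg₀) hg₀1 (hsing g₀ hg₀))
  rcases forall_toGL_mem_or_exists_eigenvector_of_dvd_card G hpG with hSL | ⟨v, hv, hB⟩
  · -- `s = (1 1; -1 0) ∈ SL₂(𝔽_p)` has `det (s - 1) = 1 ≠ 0`
    exfalso
    obtain ⟨s, hs⟩ : ∃ s : Matrix.SpecialLinearGroup (Fin 2) (ZMod p),
        (s : Matrix (Fin 2) (Fin 2) (ZMod p)) = !![1, 1; -1, 0] :=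
      ⟨⟨!![1, 1; -1, 0], by rw [Matrix.det_fin_two_of]; ring⟩, rfl⟩
    have h := hsing _ (hSL s)
    rw [Matrix.SpecialLinearGroup.coe_GL_coe_matrix, hs, det_sub_one_fin_two, Matrix.det_fin_two_of,
      Matrix.trace_fin_two_of] at h
    norm_num at h
  · refine ⟨v, hv, fun g hg ↦ ?_⟩
    obtain ⟨c, hc⟩ := hB g hg
    set N : Matrix (Fin 2) (Fin 2) (ZMod p) := (g : Matrix (Fin 2) (Fin 2) (ZMod p)) - 1 with hN
    have hNv : N *ᵥ v = (c - 1) • v := by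
      rw [hN, Matrix.sub_mulVec, Matrix.one_mulVec, hc, sub_smul, one_smul]
    have h0 : ((c - 1) * (c - 1)) • v = 0 := by
      rw [mul_smul, ← hNv, ← Matrix.mulVec_smul, ← hNv, Matrix.mulVec_mulVec, hunip g hg,
        Matrix.zero_mulVec]
    have hc1 : c = 1 := by
      rcases smul_eq_zero.mp h0 with h | h
      · exact sub_eq_zero.mp (mul_self_eq_zero.mp h)
      · exact absurd h hv
    rw [hc, hc1, one_smul]

/-! ## §2 `χ̄_p` is trivial on the inertia group `I_v`, `v ∤ p` -/

/-- For `v ∤ p`, the mod-`p` cyclotomic character is trivial on the tree's inertia group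
`GreenbergSelmer.inertia v ≤ Γ_ℚ` (`= I_{𝔓₀}`, `𝔓₀ = adicCompletionPrime ℚ v`; inertia prime to `p` fixes
`μ_p`). [cite: SerreAbelianLadic1968, Ch. I §1.2] -/
theorem modPCyclotomicCharacterZMod_eq_one_of_mem_inertia (p : ℕ) [Fact p.Prime]
    {v : HeightOneSpectrum (𝓞 ℚ)} (hpv : (p : 𝓞 ℚ) ∉ v.asIdeal) {σ : absoluteGaloisGroup ℚ}
    (hσ : σ ∈ GreenbergSelmer.inertia (K := ℚ) v) :
    modPCyclotomicCharacterZMod ℚ p σ = 1 := by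
  have hσ' : σ ∈ (adicCompletionPrime ℚ v).inertia (absoluteGaloisGroup ℚ) := by
    rw [inertia_adicCompletionPrime_eq_map_absInertia ℚ v]
    exact hσ
  refine WeierstrassCurve.modPCyclotomicCharacterZMod_eq_one_of_forall_smul_eq p σ fun t ht ↦ ?_
  exact smul_eq_self_of_mem_inertia_of_pow_prime_pow_eq_one (n := 1) hpv
    (adicCompletionPrime_mem_primesAbove ℚ v) hσ' (by rw [pow_one]; exact ht)

/-! ## §3 The lift `E[p] ⇝ T_pE`: `σ̄ − 1` injective on `E[p]` ⟹ `det (σ − 1) ∈ ℤ_p^×` -/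

/-- **If `σ̄ − 1` is injective on `E[p]` then `σ − 1` is an automorphism of `T_pE`**, so
`det (ρ_{E,p}(σ) − 1)` is a `p`-adic unit: `σ̄ − 1` is onto the finite `E[p]`, hence
`(σ − 1)T_pE + p T_pE = T_pE` (reduction `T_pE ↠ E[p]` with kernel `p T_pE`), Nakayama, and a surjective
endomorphism of a finite `ℤ_p`-module is bijective.  Valid for every prime `p` and every `σ ∈ Γ_ℚ`.
[cite: SilvermanAEC2009, Prop. III.7.1 and III.§7] -/
theorem isUnit_det_galoisRepTate_sub_one_of_injective (W : WeierstrassCurve ℚ) [W.IsElliptic]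
    (p : ℕ) [Fact p.Prime] (σ : absoluteGaloisGroup ℚ)
    (hinj : Function.Injective
      ((Multiplicative.toAdd (W.galoisRepTorsion p σ)).toAddMonoidHom -
        AddMonoidHom.id (W.geomTorsion p))) :
    IsUnit (LinearMap.det (W.galoisRepTate p σ - 1)) := by
  have hp : p.Prime := Fact.out
  haveI := WeierstrassCurve.module_finite_tateModule_holds W p
  set f : W.geomTorsion p →+ W.geomTorsion p :=
    (Multiplicative.toAdd (W.galoisRepTorsion p σ)).toAddMonoidHom -
      AddMonoidHom.id (W.geomTorsion p) with hf
  -- `E[p]` is finite, so `f` is onto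
  have hcardE : Nat.card (W.geomTorsion p) = p ^ 2 :=
    WeierstrassCurve.card_torsionPoints_eq_sq_holds W (AlgebraicClosure ℚ) (n := p)
      (Nat.cast_ne_zero.mpr hp.ne_zero)
  haveI : Finite (W.geomTorsion p) :=
    Nat.finite_of_card_ne_zero (by rw [hcardE]; exact pow_ne_zero _ hp.ne_zero)
  have hsurj : Function.Surjective f := Finite.surjective_of_injective hinj
  -- the reduction map `π : T_pE → E[p]`
  have hmem : ∀ a : W.tateModule p, TateModule.proj p 1 a ∈ W.geomTorsion p := fun a => by
    have h := WeierstrassCurve.proj_tateModule_mem_geomTorsion W p 1 a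
    rwa [pow_one] at h
  set π : W.tateModule p →+ W.geomTorsion p :=
    (TateModule.proj p 1).codRestrict (W.geomTorsion p) hmem with hπ
  have hπval : ∀ a, (π a : W.geomPoints) = TateModule.proj p 1 a := fun a => rfl
  have hπsurj : Function.Surjective π := by
    intro P
    have hP : (P : W.geomPoints) ∈ W.geomTorsion (p ^ 1 : ℕ) := by rw [pow_one]; exact P.2
    obtain ⟨a, ha⟩ := WeierstrassCurve.proj_surjective_of_isAlgClosed_holds W p 1 hP
    exact ⟨a, Subtype.ext ha⟩
  have hπsmul : ∀ a, π (σ • a) = σ • π a := fun a => Subtype.ext rfl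
  have hfπ : ∀ b : W.tateModule p, f (π b) = π (σ • b - b) := by
    intro b
    rw [map_sub, hπsmul, hf, AddMonoidHom.sub_apply, AddMonoidHom.id_apply,
      AddEquiv.coe_toAddMonoidHom]
    rfl
  -- `T = (σ - 1)T + 𝔪 T`
  set T : W.tateModule p →ₗ[ℤ_[p]] W.tateModule p := W.galoisRepTate p σ - 1 with hT
  have hle : (⊤ : Submodule ℤ_[p] (W.tateModule p)) ≤
      LinearMap.range T ⊔ IsLocalRing.maximalIdeal ℤ_[p] • ⊤ := by
    rintro a -
    obtain ⟨y, hy⟩ := hsurj (π a)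
    obtain ⟨b, rfl⟩ := hπsurj y
    rw [hfπ] at hy
    have hker : TateModule.proj p 1 (a - (σ • b - b)) = 0 := by
      rw [map_sub, sub_eq_zero, ← hπval, ← hπval, hy]
    have hmemI := TateModule.mem_maximalIdeal_smul_top_of_proj_one_eq_zero hker
    have hS : σ • b - b ∈ LinearMap.range T :=
      ⟨b, by rw [hT, LinearMap.sub_apply, WeierstrassCurve.galoisRepTate_apply_apply,
        Module.End.one_apply]⟩
    rw [show a = (σ • b - b) + (a - (σ • b - b)) by abel]
    exact Submodule.add_mem_sup hS hmemI
  have htop : (⊤ : Submodule ℤ_[p] (W.tateModule p)) ≤ LinearMap.range T :=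
    Submodule.le_of_le_smul_of_le_jacobson_bot Module.Finite.fg_top
      (IsLocalRing.maximalIdeal_le_jacobson _) hle
  have hTsurj : Function.Surjective T := LinearMap.range_eq_top.mp (top_le_iff.mp htop)
  have hTinj : Function.Injective T := OrzechProperty.injective_of_surjective_endomorphism T hTsurj
  have hcoe : ((LinearEquiv.ofBijective T ⟨hTinj, hTsurj⟩ : W.tateModule p ≃ₗ[ℤ_[p]] W.tateModule p) :
      W.tateModule p →ₗ[ℤ_[p]] W.tateModule p) = T := LinearMap.ext fun _ => rfl
  have hu := (LinearEquiv.ofBijective T ⟨hTinj, hTsurj⟩).isUnit_det'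
  rwa [hcoe] at hu

/-! ## §4 No inertia-fixed `p`-torsion ⟹ the digit (every prime `p`, every `v ∤ p`) -/

/-- **If `E[p]^{I_v} = 0` and `v ∤ p`, some `σ ∈ I_v` has `det (ρ_{E,p}(σ) − 1) ∈ ℤ_p^×`.**  Otherwise every
`σ̄ − 1`, `σ ∈ I_v`, is singular on `E[p]` (§3), the image `ρ̄(I_v) ≤ SL₂(𝔽_p)` (§2) consists of elements
with eigenvalue `1`, and §1 produces a non-zero point of `E[p]` fixed by `I_v`.  Any prime `p`.
[cite: Serre1972, §2.4 Prop. 15] -/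
theorem exists_mem_inertia_isUnit_det_sub_one_of_fixed_eq_zero (W : WeierstrassCurve ℚ) [W.IsElliptic]
    (p : ℕ) [Fact p.Prime] {v : HeightOneSpectrum (𝓞 ℚ)} (hpv : (p : 𝓞 ℚ) ∉ v.asIdeal)
    (hfix : ∀ P : W.geomTorsion p,
      (∀ σ ∈ GreenbergSelmer.inertia (K := ℚ) v, σ • P = P) → P = 0) :
    ∃ σ ∈ GreenbergSelmer.inertia (K := ℚ) v, IsUnit (LinearMap.det (W.galoisRepTate p σ - 1)) := by
  by_contra hnone
  push Not at hnone
  obtain ⟨e, Φ, he, -, hdetχ, -, -⟩ := WeierstrassCurve.exists_frame_galoisRepTorsion_rat W p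
  -- the image of inertia in `GL₂(𝔽_p)`
  set G : Subgroup (GL (Fin 2) (ZMod p)) :=
    (GreenbergSelmer.inertia (K := ℚ) v).map (Φ.toMonoidHom.comp (W.galoisRepTorsion p)) with hG
  have hmemG : ∀ σ ∈ GreenbergSelmer.inertia (K := ℚ) v, Φ (W.galoisRepTorsion p σ) ∈ G :=
    fun σ hσ ↦ Subgroup.mem_map.mpr ⟨σ, hσ, rfl⟩
  have hGmem : ∀ g ∈ G, ∃ σ ∈ GreenbergSelmer.inertia (K := ℚ) v, Φ (W.galoisRepTorsion p σ) = g := by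
    intro g hg
    obtain ⟨σ, hσ, rfl⟩ := Subgroup.mem_map.mp hg
    exact ⟨σ, hσ, rfl⟩
  -- `det = χ̄_p = 1` on the image of inertia
  have hdet1 : ∀ g ∈ G, Matrix.GeneralLinearGroup.det g = 1 := by
    intro g hg
    obtain ⟨σ, hσ, rfl⟩ := hGmem g hg
    rw [hdetχ σ, modPCyclotomicCharacterZMod_eq_one_of_mem_inertia p hpv hσ]
  -- every `σ̄ - 1`, `σ ∈ I_v`, is singular on `E[p]`
  have hsing : ∀ g ∈ G, ((g : Matrix (Fin 2) (Fin 2) (ZMod p)) - 1).det = 0 := by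
    intro g hg
    obtain ⟨σ, hσ, rfl⟩ := hGmem g hg
    set f : W.geomTorsion p →+ W.geomTorsion p :=
      (Multiplicative.toAdd (W.galoisRepTorsion p σ)).toAddMonoidHom -
        AddMonoidHom.id (W.geomTorsion p) with hf
    have hninj : ¬ Function.Injective f := fun hinj ↦
      hnone σ hσ (isUnit_det_galoisRepTate_sub_one_of_injective W p σ hinj)
    obtain ⟨x, hx0, hxne⟩ : ∃ x, f x = 0 ∧ x ≠ 0 := by
      by_contra! h
      exact hninj ((injective_iff_map_eq_zero f).mpr h)
    refine Matrix.exists_mulVec_eq_zero_iff.mp ⟨e x, fun h0 ↦ hxne (e.map_eq_zero_iff.mp h0), ?_⟩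
    rw [← WeierstrassCurve.frame_apply_sub_id_apply W p Φ e he σ x]
    change e (f x) = 0
    rw [hx0, map_zero]
  -- §1: a common fixed vector `w`, i.e. a non-zero `P = e⁻¹ w ∈ E[p]` fixed by `I_v`
  obtain ⟨w, hw0, hw⟩ := exists_forall_mulVec_eq_self_of_forall_det_sub_one_eq_zero G hdet1 hsing
  have hP0 : e.symm w ≠ 0 := fun h ↦ hw0 (by rw [← e.apply_symm_apply w, h, map_zero])
  refine hP0 (hfix (e.symm w) fun σ hσ ↦ e.injective ?_)
  have h1 : e (σ • e.symm w) = _ := he (W.galoisRepTorsion p σ) (e.symm w)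
  rw [e.apply_symm_apply, hw _ (hmemG σ hσ)] at h1
  rw [h1, e.apply_symm_apply]

/-! ## §4b The converse: the digit forces `E[p]^{I_v} = 0` (so the digit ⟺ `E[p]^{I_v} = 0`) -/

/-- **Converse of §3: if `det (ρ_{E,p}(σ) − 1) ∈ ℤ_p^×` then `σ̄ − 1` is injective on `E[p]`** (`σ − 1` is onto
`T_pE`, the reduction `T_pE ↠ E[p]` is onto and equivariant, so `σ̄ − 1` is onto the finite `E[p]`, hence
injective).  Every prime `p`, every `σ ∈ Γ_ℚ`. [cite: SilvermanAEC2009, Prop. III.7.1 and III.§7] -/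
theorem injective_sub_id_of_isUnit_det (W : WeierstrassCurve ℚ) [W.IsElliptic] (p : ℕ) [Fact p.Prime]
    (σ : absoluteGaloisGroup ℚ) (hu : IsUnit (LinearMap.det (W.galoisRepTate p σ - 1))) :
    Function.Injective
      ((Multiplicative.toAdd (W.galoisRepTorsion p σ)).toAddMonoidHom -
        AddMonoidHom.id (W.geomTorsion p)) := by
  have hp : p.Prime := Fact.out
  haveI := WeierstrassCurve.module_finite_tateModule_holds W p
  haveI := WeierstrassCurve.module_free_tateModule_holds W p
  set f : W.geomTorsion p →+ W.geomTorsion p :=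
    (Multiplicative.toAdd (W.galoisRepTorsion p σ)).toAddMonoidHom -
      AddMonoidHom.id (W.geomTorsion p) with hf
  have hcardE : Nat.card (W.geomTorsion p) = p ^ 2 :=
    WeierstrassCurve.card_torsionPoints_eq_sq_holds W (AlgebraicClosure ℚ) (n := p)
      (Nat.cast_ne_zero.mpr hp.ne_zero)
  haveI : Finite (W.geomTorsion p) :=
    Nat.finite_of_card_ne_zero (by rw [hcardE]; exact pow_ne_zero _ hp.ne_zero)
  -- `σ - 1` is onto `T_pE`
  set T : W.tateModule p →ₗ[ℤ_[p]] W.tateModule p := W.galoisRepTate p σ - 1 with hT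
  have hTsurj : Function.Surjective T :=
    ((Module.End.isUnit_iff T).mp ((LinearMap.isUnit_iff_isUnit_det T).mpr hu)).2
  -- the reduction map `π : T_pE → E[p]`
  have hmem : ∀ a : W.tateModule p, TateModule.proj p 1 a ∈ W.geomTorsion p := fun a => by
    have h := WeierstrassCurve.proj_tateModule_mem_geomTorsion W p 1 a
    rwa [pow_one] at h
  set π : W.tateModule p →+ W.geomTorsion p :=
    (TateModule.proj p 1).codRestrict (W.geomTorsion p) hmem with hπ
  have hπsurj : Function.Surjective π := by
    intro P
    have hP : (P : W.geomPoints) ∈ W.geomTorsion (p ^ 1 : ℕ) := by rw [pow_one]; exact P.2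
    obtain ⟨a, ha⟩ := WeierstrassCurve.proj_surjective_of_isAlgClosed_holds W p 1 hP
    exact ⟨a, Subtype.ext ha⟩
  have hπsmul : ∀ a, π (σ • a) = σ • π a := fun a => Subtype.ext rfl
  have hfπ : ∀ b : W.tateModule p, f (π b) = π (σ • b - b) := by
    intro b
    rw [map_sub, hπsmul, hf, AddMonoidHom.sub_apply, AddMonoidHom.id_apply,
      AddEquiv.coe_toAddMonoidHom]
    rfl
  -- `σ̄ - 1` is onto, hence injective
  have hfsurj : Function.Surjective f := by
    intro P
    obtain ⟨a, rfl⟩ := hπsurj P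
    obtain ⟨b, rfl⟩ := hTsurj a
    exact ⟨π b, by rw [hfπ, hT, LinearMap.sub_apply, WeierstrassCurve.galoisRepTate_apply_apply,
      Module.End.one_apply]⟩
  exact Finite.injective_iff_surjective.mpr hfsurj

/-- **THE DIGIT ⟺ `E[p]^{I_v} = 0`** (`v ∤ p`, every prime `p`): some `σ ∈ I_v` has `det (ρ_{E,p}(σ) − 1)` a
`p`-adic unit iff no non-zero point of `E[p]` is fixed by the inertia group `I_v`.  (⟸ is §4; ⟹: the `σ` of
the digit already has no non-zero fixed point, by §4b.)  So at `p = 3` and an additive `v ∤ 3` the digit holds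
exactly off Kodaira types `IV`, `IV*` (where `E[3]^{I_v}` is a line), and at a multiplicative `v` it fails.
[cite: Serre1972, §2.4 Prop. 15] [cite: SilvermanAEC2009, Prop. III.7.1, Thm. VII.6.1] -/
theorem exists_mem_inertia_isUnit_det_sub_one_iff (W : WeierstrassCurve ℚ) [W.IsElliptic] (p : ℕ)
    [Fact p.Prime] {v : HeightOneSpectrum (𝓞 ℚ)} (hpv : (p : 𝓞 ℚ) ∉ v.asIdeal) :
    (∃ σ ∈ GreenbergSelmer.inertia (K := ℚ) v, IsUnit (LinearMap.det (W.galoisRepTate p σ - 1))) ↔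
      ∀ P : W.geomTorsion p, (∀ σ ∈ GreenbergSelmer.inertia (K := ℚ) v, σ • P = P) → P = 0 := by
  refine ⟨fun ⟨σ, hσ, hu⟩ P hP ↦ ?_, exists_mem_inertia_isUnit_det_sub_one_of_fixed_eq_zero W p hpv⟩
  refine (injective_iff_map_eq_zero _).mp (injective_sub_id_of_isUnit_det W p σ hu) P ?_
  rw [AddMonoidHom.sub_apply, AddMonoidHom.id_apply, AddEquiv.coe_toAddMonoidHom, sub_eq_zero]
  exact hP σ hσ

/-! ## §5 Additive reduction, `p ≥ 5`: `E[p]^{I_v} = 0`, hence the digit -/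

/-- **At an additive `v ∤ p`, `p ≥ 5`, no non-zero point of `E[p]` is fixed by `I_v`**: the cyclic group
spanned by a fixed `P ≠ 0` is an inertia-fixed subgroup of `E[p]` with `p > 4` points, against the tree's
bound `#A ≤ 4` (`E(K_v^{nr})[p] ↪ E/E₀`, Silverman VII.6.1 with Tate's algorithm).
[cite: SilvermanAEC2009, Thm. VII.6.1 (PDF p. 177) and proof of Thm. VII.7.1 (PDF p. 179)]
[cite: SilvermanATAEC1994, Thm. IV.10.2(a), additive case (PDF pp. 358–359)] -/
theorem geomTorsion_fixed_eq_zero_of_hasAdditiveReductionAt (W : WeierstrassCurve ℚ) [W.IsElliptic]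
    (p : ℕ) [Fact p.Prime] (hp5 : 5 ≤ p) {v : HeightOneSpectrum (𝓞 ℚ)} (hpv : (p : 𝓞 ℚ) ∉ v.asIdeal)
    (hadd : W.HasAdditiveReductionAt v) (P : W.geomTorsion p)
    (hP : ∀ σ ∈ GreenbergSelmer.inertia (K := ℚ) v, σ • P = P) : P = 0 := by
  by_contra hP0
  have hP0' : (P : W.geomPoints) ≠ 0 := fun h ↦ hP0 (ZeroMemClass.coe_eq_zero.mp h)
  have hfixP : ∀ τ ∈ absInertia (v.adicCompletion ℚ),
      absGaloisRestrict ℚ (v.adicCompletion ℚ) τ • (P : W.geomPoints) = P := by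
    intro τ hτ
    have hτ' : absGaloisRestrict ℚ (v.adicCompletion ℚ) τ ∈ GreenbergSelmer.inertia (K := ℚ) v :=
      Subgroup.mem_map_of_mem (absGaloisRestrict ℚ (v.adicCompletion ℚ)).toMonoidHom hτ
    exact congrArg Subtype.val (hP _ hτ')
  have hle4 := W.natCard_le_four_of_absInertia_fixed_of_hasAdditiveReductionAt hadd hpv
    (AddSubgroup.zmultiples (P : W.geomPoints)) (AddSubgroup.zmultiples_le_of_mem P.2)
    (fun τ hτ Q hQ ↦ by
      obtain ⟨k, rfl⟩ := AddSubgroup.mem_zmultiples_iff.mp hQ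
      have hk := map_zsmul (DistribSMul.toAddMonoidHom W.geomPoints
        (absGaloisRestrict ℚ (v.adicCompletion ℚ) τ)) k (P : W.geomPoints)
      simpa only [DistribSMul.toAddMonoidHom_apply, hfixP τ hτ] using hk)
  have hpP : p • (P : W.geomPoints) = 0 := by
    have h := (Submodule.mem_torsionBy_iff _ _).mp P.2
    rwa [natCast_zsmul] at h
  rw [Nat.card_zmultiples, addOrderOf_eq_prime hpP hP0'] at hle4
  omega

/-- **THE DIGIT, raw form:** at an additive `v ∤ p`, `p ≥ 5`, some `σ ∈ I_v` has `det (ρ_{E,p}(σ) − 1) ∈ ℤ_p^×`.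
[cite: Serre1972, §2.4 Prop. 15] [cite: SilvermanAEC2009, Thm. VII.6.1, Prop. III.7.1] -/
theorem exists_mem_inertia_isUnit_det_sub_one_of_hasAdditiveReductionAt (W : WeierstrassCurve ℚ)
    [W.IsElliptic] (p : ℕ) [Fact p.Prime] (hp5 : 5 ≤ p) {v : HeightOneSpectrum (𝓞 ℚ)}
    (hpv : (p : 𝓞 ℚ) ∉ v.asIdeal) (hadd : W.HasAdditiveReductionAt v) :
    ∃ σ ∈ GreenbergSelmer.inertia (K := ℚ) v, IsUnit (LinearMap.det (W.galoisRepTate p σ - 1)) :=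
  exists_mem_inertia_isUnit_det_sub_one_of_fixed_eq_zero W p hpv
    (geomTorsion_fixed_eq_zero_of_hasAdditiveReductionAt W p hp5 hpv hadd)

end Summit.BirchSwinnertonDyer.BirchSwinnertonDyer.Theorems.OneSidedTwistSqueezeX9KatoDivisibilityX9ULedger
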